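/-
Copyright (c) 2026 the pub-hodgecm-mathlib formalisation cell (harness21).  Prover seat hodgecm-mathlib-K2E1-p15 (g3), Track B ∕ K2-LIT, h413 = `stmt-HodgeConjecture-24833`,
R90-TF section S8 «ContSpec-n½» (#4′ road, letter (D) «density of the `K`-isotypic pieces» of the LAYER 2 PRINT ★ p862113; this seat's road 2026-09-04T16:45:39Z, item (D-arch)):
PETER–WEYL FOR A COMPACT ABELIAN GROUP IN A HILBERT REPRESENTATION — the eigenspaces of the characters span a dense subspace.
-/
import Summits.HodgeConjecture.HodgeConjecture.Theorems.K2E1CompactAbelianIsotypicApproximationU   -- ★ (K2E1-p15 (g0)): `exists_finset_character_sup_approx` (trigonometric polynomials are sup-dense in `C(C, ℂ)`), `integrable_of_continuous`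
import Literature.NumberTheory.Automorphic.HilbertRepSpectrum                                       -- ★ `ContRepresentation.IsUnitary` (`norm_map`), `IsStronglyContinuous`
import Mathlib.MeasureTheory.Function.L2Space                                                      -- Mathlib `integral_inner`
import Mathlib.Analysis.InnerProductSpace.Projection.Submodule                                     -- Mathlib `Submodule.topologicalClosure_eq_top_iff`
import HarnessLib

/-!
# S8 #4′ road, letter (D-arch) — `R90S8CompactAbelianIsotypicDense`: for a unitary, strongly continuous representation of a COMPACT ABELIAN group `C` on a complex Hilbert space `H`, the joint
# eigenspaces `H_χ = {v | π(c) v = χ(c) v ∀ c}`, `χ ∈ Ĉ`, span a DENSE subspace: `closure ⨆_χ H_χ = H`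

Track B ∕ K2-LIT, crux h413 = `stmt-HodgeConjecture-24833`, route of record `HCCMUnconditional`; cell `hodgecm-mathlib`, R90-TF programme, section S8 «ContSpec-n½», socket #4′
(`sock_S8_resH_spannedByCharLines`).  The `K_∞`-half of letter (D) `hD` of ★ `residual_le_topologicalClosure_iSup_charLines_of_letters` (at `U(J₂)`, `K_∞ ≅ U(1) × U(1)` is compact ABELIAN;
the `K′_f`-half is ★ `DiscreteAutomorphicRep.dense_finRep_smoothPart`; the `(K_∞·K′_f, ω̃)` glue is K2E2-p12's (D-glue)).  GENERIC; THEOREMS ONLY (no `def`, no `instance`, no `notation`, no named-fact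
hypothesis, no `sorry`; default heartbeats); lane `--supports stmt-HodgeConjecture-24833 --as helper` (count-neutral).  Closes no socket.

THE MATHEMATICS ([BrockerTomDieck1985, III (5.7), (5.10)]; [DeitmarEchterhoff2014, Thm. 3.4.6, Prop. 3.5.2]; [Folland1995, Thm. 5.11]).  Let `μ` be the Haar probability measure of `C`,
`π` unitary and strongly continuous on `H`, and for `χ ∈ Ĉ` put `P_χ v := ∫_C χ(c)·π(c)v dμ(c)` (Bochner).  (1) `P_χ v ∈ H_{χ⁻¹}`: `π(c₀)P_χ v = ∫ χ(c) π(c₀c)v = ∫ χ(c₀⁻¹c) π(c) v = χ(c₀)⁻¹·P_χ v`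
(left invariance).  (2) If `v ⟂ H_ψ` for every `ψ`, then `0 = ⟪v, P_χ v⟫ = ∫ χ(c)·f(c) dμ` with `f(c) := ⟪v, π(c)v⟫` continuous, `|f| ≤ ‖v‖²`; i.e. ALL FOURIER COEFFICIENTS OF `f` VANISH.  (3) Trigonometric
polynomials `p = Σ a_χ χ` are sup-dense in `C(C, ℂ)` (★ `exists_finset_character_sup_approx`, Stone–Weierstrass): approximating `f̄` within `δ`, `∫ |f|² = ∫ f̄ f = ∫ (f̄ − p) f ≤ δ‖v‖²`, so `∫ |f|² = 0`,
`f = 0` a.e., hence everywhere (`f` continuous, `μ` charges opens), and `f(1) = ‖v‖² = 0`: `v = 0`.  (4) So `(⨆_χ H_χ)ᗮ = 0`, i.e. `closure ⨆_χ H_χ = H` (Mathlib `Submodule.topologicalClosure_eq_top_iff`).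
* §1 `continuous_char_smul_apply`, **`integral_char_smul_apply_mem_iInf_eigenspace`** (1), `inner_integral_char_smul_apply` (2).
* §2 `integral_norm_sq_inner_eq_zero_of_forall` (3), **`iSup_iInf_eigenspace_topologicalClosure_eq_top`** — THE HEAD (4), and `le_topologicalClosure_iSup_iInf_eigenspace` (`⊤ ≤` form).
HONEST LABEL: HC_CM is proved only modulo the 7 printed citations (2 remaining named inputs: hLiu418 = `stmt-HodgeConjecture-24832`, h413 = `stmt-HodgeConjecture-24833`) until
rung 0 closes; REL ≠ ★ ≠ BUILT; this file asserts no named fact and closes no socket; count-neutral.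

## References
* [BrockerTomDieck1985] T. Bröcker, T. tom Dieck, *Representations of Compact Lie Groups*, GTM 98 (1985), III (5.7), (5.10).
* [DeitmarEchterhoff2014] A. Deitmar, S. Echterhoff, *Principles of Harmonic Analysis*, 2nd ed. (2014), Thm. 3.4.6, Prop. 3.5.2.
* [Folland1995] G. B. Folland, *A Course in Abstract Harmonic Analysis* (1995), Thm. 5.11.
-/

set_option autoImplicit false
set_option linter.dupNamespace false  -- the mandated namespace `…HodgeConjecture.HodgeConjecture.R90.S8` (LEAD #1 L1) repeats the summit's segment

noncomputable section

open MeasureTheory Set Filter Topology ContRepresentation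
open scoped InnerProductSpace ComplexConjugate
open Summit.HodgeConjecture.HodgeConjecture.Cruxes.H413.K2E1CompactAbelianIsotypicApproximationU (exists_finset_character_sup_approx integrable_of_continuous)

namespace Summit.HodgeConjecture.HodgeConjecture.R90.S8

variable {C : Type*} [CommGroup C] [TopologicalSpace C] [IsTopologicalGroup C] [CompactSpace C] [T2Space C] [MeasurableSpace C] [BorelSpace C]
  (μC : Measure C) [IsProbabilityMeasure μC] [μC.IsMulLeftInvariant] [μC.IsOpenPosMeasure]
  {H : Type*} [NormedAddCommGroup H] [InnerProductSpace ℂ H] [CompleteSpace H]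
  {π : ContRepresentation ℂ C H}

/-! ## §1 The averaged vectors `P_χ v = ∫ χ(c)·π(c)v` are joint eigenvectors -/

omit [IsTopologicalGroup C] [CompactSpace C] [T2Space C] [MeasurableSpace C] [BorelSpace C] [CompleteSpace H] in
/-- `c ↦ χ(c)·π(c)v` is continuous (strong continuity of `π`, continuity of `χ`). [folklore] -/
theorem continuous_char_smul_apply (hsc : π.IsStronglyContinuous) (χ : PontryaginDual C) (v : H) :
    Continuous fun c : C => ((χ c : Circle) : ℂ) • π c v :=
  ((continuous_subtype_val.comp (map_continuous χ)).smul (hsc v))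

omit [T2Space C] [μC.IsOpenPosMeasure] in
/-- **(1) `P_χ v ∈ H_{χ⁻¹}`**: `π(c₀) (∫ χ(c)·π(c)v dμ) = χ(c₀)⁻¹·∫ χ(c)·π(c)v dμ` for every `c₀` — push `π(c₀)` inside (Mathlib `ContinuousLinearMap.integral_comp_comm`), use `π(c₀)π(c) = π(c₀c)`,
and substitute `c ↦ c₀⁻¹c` (left invariance, Mathlib `integral_mul_left_eq_self`). [cite: BrockerTomDieck1985, III (5.10)] -/
theorem integral_char_smul_apply_mem_iInf_eigenspace (hsc : π.IsStronglyContinuous) (χ : PontryaginDual C) (v : H) :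
    (∫ c, ((χ c : Circle) : ℂ) • π c v ∂μC) ∈
      ⨅ c₀ : C, Module.End.eigenspace ((π c₀ : H →L[ℂ] H) : H →ₗ[ℂ] H) ((χ⁻¹ c₀ : Circle) : ℂ) := by
  refine (Submodule.mem_iInf _).mpr fun c₀ => Module.End.mem_eigenspace_iff.mpr ?_
  have hint : Integrable (fun c : C => ((χ c : Circle) : ℂ) • π c v) μC := integrable_of_continuous μC (continuous_char_smul_apply hsc χ v)
  change (π c₀ : H →L[ℂ] H) (∫ c, ((χ c : Circle) : ℂ) • π c v ∂μC) = ((χ⁻¹ c₀ : Circle) : ℂ) • ∫ c, ((χ c : Circle) : ℂ) • π c v ∂μC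
  rw [← (π c₀ : H →L[ℂ] H).integral_comp_comm hint]
  -- `π c₀ (χ c • π c v) = χ c • π (c₀ * c) v`
  have h1 : (fun c => (π c₀ : H →L[ℂ] H) (((χ c : Circle) : ℂ) • π c v)) = fun c => ((χ c : Circle) : ℂ) • π (c₀ * c) v := by
    funext c
    rw [map_smul, map_mul]
    rfl
  rw [h1]
  -- substitute `c ↦ c₀⁻¹ c`
  have h2 : (∫ c, ((χ c : Circle) : ℂ) • π (c₀ * c) v ∂μC) = ∫ c, ((χ (c₀⁻¹ * c) : Circle) : ℂ) • π c v ∂μC := by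
    have := integral_mul_left_eq_self (μ := μC) (fun c => ((χ (c₀⁻¹ * c) : Circle) : ℂ) • π c v) c₀
    simp only [inv_mul_cancel_left] at this
    exact this
  rw [h2]
  have h3 : (fun c => ((χ (c₀⁻¹ * c) : Circle) : ℂ) • π c v) = fun c => ((χ⁻¹ c₀ : Circle) : ℂ) • (((χ c : Circle) : ℂ) • π c v) := by
    funext c
    rw [smul_smul, map_mul, map_inv, Circle.coe_mul]
    rfl
  rw [h3, integral_smul]

omit [IsTopologicalGroup C] [CompactSpace C] [T2Space C] [μC.IsMulLeftInvariant] [μC.IsOpenPosMeasure] in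
/-- **(2) `⟪v, P_χ v⟫ = ∫ χ(c)·⟪v, π(c)v⟫ dμ`** (Mathlib `integral_inner`, `inner_smul_right`). [folklore] -/
theorem inner_integral_char_smul_apply [CompactSpace C] (hsc : π.IsStronglyContinuous) (χ : PontryaginDual C) (v : H) :
    ⟪v, ∫ c, ((χ c : Circle) : ℂ) • π c v ∂μC⟫_ℂ = ∫ c, ((χ c : Circle) : ℂ) * ⟪v, π c v⟫_ℂ ∂μC := by
  rw [← integral_inner (integrable_of_continuous μC (continuous_char_smul_apply hsc χ v))]
  exact integral_congr_ae (Eventually.of_forall fun c => inner_smul_right _ _ _)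

/-! ## §2 All Fourier coefficients of `c ↦ ⟪v, π(c)v⟫` vanish ⟹ `v = 0`; the head -/

omit [μC.IsMulLeftInvariant] [μC.IsOpenPosMeasure] [CompleteSpace H] in
/-- **(3) A continuous `f : C → ℂ` all of whose «Fourier coefficients» `∫ χ·f dμ` vanish has `∫ ‖f‖² dμ = 0`**: approximate `f̄` uniformly by trigonometric polynomials (★
`exists_finset_character_sup_approx`), so `∫ ‖f‖² = ∫ f̄·f = ∫ (f̄ − p)·f` is `≤ δ·sup‖f‖` for every `δ > 0`. [cite: DeitmarEchterhoff2014, Prop. 3.5.2] [cite: Folland1995, Thm. 5.11] -/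
theorem integral_norm_sq_eq_zero_of_forall {f : C → ℂ} (hf : Continuous f) {B : ℝ} (hB : ∀ c, ‖f c‖ ≤ B)
    (h : ∀ χ : PontryaginDual C, ∫ c, ((χ c : Circle) : ℂ) * f c ∂μC = 0) :
    ∫ c, ‖f c‖ ^ 2 ∂μC = 0 := by
  classical
  have hB0 : 0 ≤ B := (norm_nonneg _).trans (hB 1)
  -- `∫ ‖f‖² = re ∫ f̄ f`
  have hff : Integrable (fun c => conj (f c) * f c) μC := integrable_of_continuous μC ((Complex.continuous_conj.comp hf).mul hf)
  have hsq : (∫ c, ‖f c‖ ^ 2 ∂μC : ℝ) = (∫ c, conj (f c) * f c ∂μC).re := by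
    have h1 : (fun c => conj (f c) * f c) = fun c => ((‖f c‖ ^ 2 : ℝ) : ℂ) := by
      funext c
      rw [RCLike.conj_mul]
      norm_cast
    rw [h1, integral_complex_ofReal, Complex.ofReal_re]
  -- the estimate `|∫ f̄ f| ≤ δ B` for every `δ > 0`
  have hest : ∀ δ : ℝ, 0 < δ → ‖∫ c, conj (f c) * f c ∂μC‖ ≤ δ * B := by
    intro δ hδ
    obtain ⟨s, a, hs⟩ := exists_finset_character_sup_approx (C := C) ⟨fun c => conj (f c), Complex.continuous_conj.comp hf⟩ hδ
    -- `∫ p f = 0` for the trigonometric polynomial `p = Σ a_χ χ`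
    have hp : ∫ c, (∑ χ ∈ s, a χ * ((χ c : Circle) : ℂ)) * f c ∂μC = 0 := by
      have hint : ∀ χ ∈ s, Integrable (fun c => a χ * (((χ c : Circle) : ℂ) * f c)) μC := fun χ _ =>
        (integrable_of_continuous μC ((continuous_subtype_val.comp (map_continuous χ)).mul hf)).const_mul _
      have h1 : (fun c => (∑ χ ∈ s, a χ * ((χ c : Circle) : ℂ)) * f c) = fun c => ∑ χ ∈ s, a χ * (((χ c : Circle) : ℂ) * f c) := by
        funext c
        rw [Finset.sum_mul]
        exact Finset.sum_congr rfl fun χ _ => mul_assoc _ _ _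
      rw [h1, integral_finsetSum _ hint]
      refine Finset.sum_eq_zero fun χ _ => ?_
      rw [integral_const_mul, h χ, mul_zero]
    -- `∫ f̄ f = ∫ (f̄ − p) f`
    have hpf : Integrable (fun c => (∑ χ ∈ s, a χ * ((χ c : Circle) : ℂ)) * f c) μC :=
      integrable_of_continuous μC ((continuous_finsetSum _ fun χ _ => continuous_const.mul (continuous_subtype_val.comp (map_continuous χ))).mul hf)
    have hsplit : (∫ c, conj (f c) * f c ∂μC) = ∫ c, (conj (f c) - ∑ χ ∈ s, a χ * ((χ c : Circle) : ℂ)) * f c ∂μC := by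
      have h1 : (fun c => (conj (f c) - ∑ χ ∈ s, a χ * ((χ c : Circle) : ℂ)) * f c) = fun c => conj (f c) * f c - (∑ χ ∈ s, a χ * ((χ c : Circle) : ℂ)) * f c := by
        funext c; ring
      rw [h1, integral_sub hff hpf, hp, sub_zero]
    rw [hsplit]
    -- pointwise bound `‖(f̄ − p) f‖ ≤ δ B`
    have hbound : ∀ c, ‖(conj (f c) - ∑ χ ∈ s, a χ * ((χ c : Circle) : ℂ)) * f c‖ ≤ δ * B := fun c => by
      rw [norm_mul]
      exact mul_le_mul (hs c) (hB c) (norm_nonneg _) hδ.le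
    calc ‖∫ c, (conj (f c) - ∑ χ ∈ s, a χ * ((χ c : Circle) : ℂ)) * f c ∂μC‖
        ≤ ∫ c, ‖(conj (f c) - ∑ χ ∈ s, a χ * ((χ c : Circle) : ℂ)) * f c‖ ∂μC := norm_integral_le_integral_norm _
      _ ≤ ∫ _c, δ * B ∂μC := integral_mono_of_nonneg (Eventually.of_forall fun c => norm_nonneg _) (integrable_const _) (Eventually.of_forall hbound)
      _ = δ * B := by rw [integral_const, probReal_univ, one_smul]
  -- hence `∫ f̄ f = 0`
  have hzero : (∫ c, conj (f c) * f c ∂μC) = 0 := by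
    by_contra hne
    have hpos : 0 < ‖∫ c, conj (f c) * f c ∂μC‖ := norm_pos_iff.mpr hne
    by_cases hB' : B = 0
    · have := hest 1 one_pos
      rw [hB', mul_zero] at this
      exact absurd this (not_le.mpr hpos)
    · have hBpos : 0 < B := lt_of_le_of_ne hB0 (Ne.symm hB')
      have := hest (‖∫ c, conj (f c) * f c ∂μC‖ / (2 * B)) (by positivity)
      rw [div_mul_eq_mul_div, mul_comm (2 : ℝ) B, ← div_div, mul_div_assoc, div_self hB', mul_one] at this
      linarith
  rw [hsq, hzero, Complex.zero_re]

omit [μC.IsMulLeftInvariant] in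
/-- **THE HEAD — PETER–WEYL FOR A COMPACT ABELIAN GROUP IN A HILBERT REPRESENTATION**: for `π` unitary and strongly continuous on the complex Hilbert space `H` and `μ` a left-invariant
probability measure on `C` charging opens (Haar), the joint eigenspaces `H_χ = ⨅_c ker(π(c) − χ(c))`, `χ ∈ Ĉ = PontryaginDual C`, span a DENSE subspace:
`(⨆_χ H_χ).topologicalClosure = ⊤`.  Proof: a vector `v` orthogonal to every `H_χ` is orthogonal to each `P_χ v ∈ H_{χ⁻¹}` (§1), so every Fourier coefficient of the continuous
`f(c) = ⟪v, π(c)v⟫` vanishes; by §2 (3) `∫ |f|² = 0`, so `f ≡ 0` (`μ` charges opens) and `f(1) = ‖v‖² = 0`. [cite: BrockerTomDieck1985, III (5.7), (5.10)] [cite: DeitmarEchterhoff2014, Thm. 3.4.6] -/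
theorem iSup_iInf_eigenspace_topologicalClosure_eq_top [μC.IsMulLeftInvariant] (hπ : π.IsUnitary) (hsc : π.IsStronglyContinuous) :
    (⨆ χ : PontryaginDual C, ⨅ c : C, Module.End.eigenspace ((π c : H →L[ℂ] H) : H →ₗ[ℂ] H) ((χ c : Circle) : ℂ)).topologicalClosure = ⊤ := by
  rw [Submodule.topologicalClosure_eq_top_iff, Submodule.eq_bot_iff]
  intro v hv
  -- `f(c) = ⟪v, π c v⟫`: continuous, bounded by `‖v‖²`, all Fourier coefficients zero
  set f : C → ℂ := fun c => ⟪v, π c v⟫_ℂ with hfdef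
  have hfc : Continuous f := continuous_const.inner (hsc v)
  have hfB : ∀ c, ‖f c‖ ≤ ‖v‖ * ‖v‖ := fun c => by
    calc ‖f c‖ ≤ ‖v‖ * ‖π c v‖ := norm_inner_le_norm _ _
      _ = ‖v‖ * ‖v‖ := by rw [hπ.norm_map]
  have hcoef : ∀ χ : PontryaginDual C, ∫ c, ((χ c : Circle) : ℂ) * f c ∂μC = 0 := by
    intro χ
    rw [← inner_integral_char_smul_apply μC hsc χ v]
    -- `P_χ v ∈ H_{χ⁻¹} ≤ ⨆ H_ψ`, and `v ⟂` that
    have hmem : (∫ c, ((χ c : Circle) : ℂ) • π c v ∂μC) ∈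
        ⨆ ψ : PontryaginDual C, ⨅ c : C, Module.End.eigenspace ((π c : H →L[ℂ] H) : H →ₗ[ℂ] H) ((ψ c : Circle) : ℂ) :=
      Submodule.mem_iSup_of_mem χ⁻¹ (integral_char_smul_apply_mem_iInf_eigenspace μC hsc χ v)
    exact (Submodule.mem_orthogonal' _ _).mp hv _ hmem
  -- hence `∫ ‖f‖² = 0`, `f = 0` a.e., `f = 0` (continuity + open-positivity), `f 1 = ‖v‖² = 0`
  have hI : ∫ c, ‖f c‖ ^ 2 ∂μC = 0 := integral_norm_sq_eq_zero_of_forall μC hfc hfB hcoef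
  have hae : (fun c => ‖f c‖ ^ 2) =ᵐ[μC] 0 :=
    (integral_eq_zero_iff_of_nonneg (fun c => sq_nonneg _) (integrable_of_continuous μC ((continuous_norm.comp hfc).pow 2))).mp hI
  have heq : (fun c => ‖f c‖ ^ 2) = 0 :=
    (Continuous.ae_eq_iff_eq μC ((continuous_norm.comp hfc).pow 2) continuous_const).mp hae
  have h1 : ‖f 1‖ ^ 2 = 0 := congrFun heq 1
  have hf1 : f 1 = 0 := by
    have := (sq_eq_zero_iff.mp h1)
    exact norm_eq_zero.mp this
  have : ⟪v, v⟫_ℂ = 0 := by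
    have h := hf1
    rw [hfdef] at h
    simpa [map_one] using h
  exact inner_self_eq_zero.mp this

omit [μC.IsMulLeftInvariant] in
/-- **`⊤ ≤ closure ⨆_χ H_χ`** (the `≤` form consumers plug into ★ `le_topologicalClosure_of_block_letters`' letter (D)). [cite: BrockerTomDieck1985, III (5.7)] -/
theorem le_topologicalClosure_iSup_iInf_eigenspace [μC.IsMulLeftInvariant] (hπ : π.IsUnitary) (hsc : π.IsStronglyContinuous) (W : Submodule ℂ H) :
    W ≤ (⨆ χ : PontryaginDual C, ⨅ c : C, Module.End.eigenspace ((π c : H →L[ℂ] H) : H →ₗ[ℂ] H) ((χ c : Circle) : ℂ)).topologicalClosure := by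
  rw [iSup_iInf_eigenspace_topologicalClosure_eq_top μC hπ hsc]
  exact le_top

end Summit.HodgeConjecture.HodgeConjecture.R90.S8

end
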